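import Mathlib

/-!
# The method of conditional expectations on the Boolean cube, relational finite form — line «sfm-bl»
(PROOF-SFM-BL §5 step (2) / §6 (ii): the one-pass greedy on the joint potential Ψ)

FRONTIER F-N1c; nothing here bears on P vs NP.

Let `f : (Fin m → Bool) → K` take values in an ordered additive monoid (in the sfm-bl argument:
`K = ℚ` or `ℝ`, `f(T) = tr(Ã_{R,T}^L)/A₁ + Σ_S ê_{B_S}(T)/A₃ ≥ 0`).  For a point `T` and `k ≤ m` write
`P_k(T) := Σ { f T' : T' agrees with T on the coordinates < k }` — `2^{m-k}` times the conditional mean of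
`f` given the first `k` coordinates of `T`.  If `T` is a GREEDY PATH, i.e. for every `k < m` the class that
ALSO agrees at coordinate `k` is not heavier than the class that agrees below `k` and DISAGREES at `k`
(`h` below — this is exactly «set `T_k` to the value minimising the conditional expectation»), then
`2^m • f(T) ≤ Σ_{T'} f(T')` (`two_pow_smul_le_sum_of_greedy`): the greedy point is at most the average.
Corollary over an ordered field: `Σ_{T'} f T' < 2^m · c ⇒ f T < c` (`lt_of_greedy_of_sum_lt`) — with
`c = 1` this is «Ψ(∅) < 1 ⇒ F(T_final) < 1» of PROOF-SFM-BL §6 (ii).  Everything is a `Finset.sum`; no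
measure theory, no division in the hypotheses (ref PREPARED-CHECKS-sfm-bl S4/L4: finite sums only).
The statement is RELATIONAL (a property of the output point), so a program that computes the conditional
sums in any exact representation and takes the lighter branch discharges `h` directly.
-/

namespace Summit.PneNP.PneNP.Theorems.SfmBl

open Finset BigOperators

variable {m : ℕ} {K : Type*} [AddCommMonoid K] [PartialOrder K] [IsOrderedAddMonoid K]

/-- The class of points agreeing with `T` on all coordinates `< 0` is everything. -/
theorem filter_agree_zero (T : Fin m → Bool) :
    (Finset.univ.filter fun T' : Fin m → Bool => ∀ i : Fin m, (i : ℕ) < 0 → T' i = T i) = Finset.univ := by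
  ext T'; simp

/-- The class of points agreeing with `T` on all coordinates `< m` is `{T}`. -/
theorem filter_agree_self (T : Fin m → Bool) :
    (Finset.univ.filter fun T' : Fin m → Bool => ∀ i : Fin m, (i : ℕ) < m → T' i = T i) = {T} := by
  ext T'
  simp only [Finset.mem_filter, Finset.mem_univ, true_and, Finset.mem_singleton]
  constructor
  · intro h; funext i; exact h i i.isLt
  · rintro rfl i _; rfl

omit [PartialOrder K] [IsOrderedAddMonoid K] in
/-- Splitting a prefix class at the next coordinate: the points agreeing with `T` below `k` are those that
also agree at `k` plus those that disagree at `k` (as a sum identity). -/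
theorem sum_filter_agree_split (f : (Fin m → Bool) → K) (T : Fin m → Bool) (k : ℕ) (hk : k < m) :
    ∑ T' ∈ Finset.univ.filter (fun T' : Fin m → Bool => ∀ i : Fin m, (i : ℕ) < k → T' i = T i), f T'
      = ∑ T' ∈ Finset.univ.filter (fun T' : Fin m → Bool => ∀ i : Fin m, (i : ℕ) < k + 1 → T' i = T i), f T'
        + ∑ T' ∈ Finset.univ.filter
            (fun T' : Fin m → Bool => (∀ i : Fin m, (i : ℕ) < k → T' i = T i) ∧ T' ⟨k, hk⟩ ≠ T ⟨k, hk⟩), f T' := by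
  classical
  rw [← Finset.sum_union]
  · congr 1
    ext T'
    simp only [Finset.mem_filter, Finset.mem_univ, true_and, Finset.mem_union]
    constructor
    · intro h
      by_cases hT : T' ⟨k, hk⟩ = T ⟨k, hk⟩
      · left
        intro i hi
        rcases Nat.lt_succ_iff_lt_or_eq.1 hi with hi' | hi'
        · exact h i hi'
        · have : i = ⟨k, hk⟩ := Fin.ext hi'
          rw [this]; exact hT
      · right; exact ⟨h, hT⟩
    · rintro (h | ⟨h, _⟩)
      · exact fun i hi => h i (Nat.lt_succ_of_lt hi)
      · exact h
  · rw [Finset.disjoint_filter]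
    intro T' _ h1 h2
    exact h2.2 (h1 ⟨k, hk⟩ (Nat.lt_succ_self k))

/-- THE METHOD OF CONDITIONAL EXPECTATIONS (relational form).  If at every coordinate `k < m` the class of
points agreeing with `T` on `≤ k` weighs at most the class agreeing on `< k` and disagreeing at `k`
(`T` always took the lighter branch), then `2^m • f T ≤ Σ_{T'} f T'`. -/
theorem two_pow_smul_le_sum_of_greedy (f : (Fin m → Bool) → K) (T : Fin m → Bool)
    (h : ∀ (k : ℕ) (hk : k < m),
      ∑ T' ∈ Finset.univ.filter (fun T' : Fin m → Bool => ∀ i : Fin m, (i : ℕ) < k + 1 → T' i = T i), f T'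
        ≤ ∑ T' ∈ Finset.univ.filter
            (fun T' : Fin m → Bool => (∀ i : Fin m, (i : ℕ) < k → T' i = T i) ∧ T' ⟨k, hk⟩ ≠ T ⟨k, hk⟩), f T') :
    2 ^ m • f T ≤ ∑ T', f T' := by
  classical
  -- `P k` = weight of the class agreeing with `T` below `k`
  set P : ℕ → K := fun k =>
    ∑ T' ∈ Finset.univ.filter (fun T' : Fin m → Bool => ∀ i : Fin m, (i : ℕ) < k → T' i = T i), f T' with hP
  have hPm : P m = f T := by simp only [hP, filter_agree_self, Finset.sum_singleton]
  have hP0 : P 0 = ∑ T', f T' := by simp only [hP, filter_agree_zero]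
  -- one step: `2 • P (k+1) ≤ P k`
  have step : ∀ k, k < m → 2 • P (k + 1) ≤ P k := by
    intro k hk
    have hsplit := sum_filter_agree_split f T k hk
    simp only [hP]
    rw [hsplit, two_nsmul]
    exact add_le_add_right (h k hk) _
  -- iterate: `2^d • P m ≤ P (m - d)` for `d ≤ m`
  have iter : ∀ d, d ≤ m → 2 ^ d • P m ≤ P (m - d) := by
    intro d
    induction d with
    | zero => intro _; simp
    | succ d ih =>
      intro hd
      have hk : m - (d + 1) < m := by omega
      have e : m - (d + 1) + 1 = m - d := by omega
      calc 2 ^ (d + 1) • P m = 2 • (2 ^ d • P m) := by rw [pow_succ, mul_comm, mul_smul]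
        _ ≤ 2 • P (m - d) := nsmul_le_nsmul_right (ih (by omega)) 2
        _ = 2 • P (m - (d + 1) + 1) := by rw [e]
        _ ≤ P (m - (d + 1)) := step _ hk
  have := iter m le_rfl
  rwa [hPm, Nat.sub_self, hP0] at this

/-- COROLLARY over an ordered field (the form used in PROOF-SFM-BL §6 (ii)): if the total weight is
`< 2^m · c` (average `< c`) and `T` is a greedy path, then `f T < c`. -/
theorem lt_of_greedy_of_sum_lt {F : Type*} [Field F] [LinearOrder F] [IsStrictOrderedRing F]
    (f : (Fin m → Bool) → F) (T : Fin m → Bool)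
    (h : ∀ (k : ℕ) (hk : k < m),
      ∑ T' ∈ Finset.univ.filter (fun T' : Fin m → Bool => ∀ i : Fin m, (i : ℕ) < k + 1 → T' i = T i), f T'
        ≤ ∑ T' ∈ Finset.univ.filter
            (fun T' : Fin m → Bool => (∀ i : Fin m, (i : ℕ) < k → T' i = T i) ∧ T' ⟨k, hk⟩ ≠ T ⟨k, hk⟩), f T')
    {c : F} (hc : ∑ T', f T' < 2 ^ m * c) : f T < c := by
  have h1 := two_pow_smul_le_sum_of_greedy f T h
  rw [nsmul_eq_mul, Nat.cast_pow, Nat.cast_ofNat] at h1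
  have h2 : (2 : F) ^ m * f T < 2 ^ m * c := lt_of_le_of_lt h1 hc
  exact lt_of_mul_lt_mul_left h2 (by positivity)

/-- COROLLARY (`≤` form): total weight `≤ 2^m · c` and `T` greedy ⇒ `f T ≤ c`. -/
theorem le_of_greedy_of_sum_le {F : Type*} [Field F] [LinearOrder F] [IsStrictOrderedRing F]
    (f : (Fin m → Bool) → F) (T : Fin m → Bool)
    (h : ∀ (k : ℕ) (hk : k < m),
      ∑ T' ∈ Finset.univ.filter (fun T' : Fin m → Bool => ∀ i : Fin m, (i : ℕ) < k + 1 → T' i = T i), f T'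
        ≤ ∑ T' ∈ Finset.univ.filter
            (fun T' : Fin m → Bool => (∀ i : Fin m, (i : ℕ) < k → T' i = T i) ∧ T' ⟨k, hk⟩ ≠ T ⟨k, hk⟩), f T')
    {c : F} (hc : ∑ T', f T' ≤ 2 ^ m * c) : f T ≤ c := by
  have h1 := two_pow_smul_le_sum_of_greedy f T h
  rw [nsmul_eq_mul, Nat.cast_pow, Nat.cast_ofNat] at h1
  exact le_of_mul_le_mul_left (h1.trans hc) (by positivity)

/-- EXISTENCE OF A GREEDY PATH is not the point (the algorithm constructs one); but for completeness: the two
branch classes at coordinate `k` below a common prefix have the same cardinality `2^(m-k-1)`, so «lighter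
branch» is the same as «smaller conditional mean».  Recorded as the cardinality of a prefix class:
`#{T' : T' agrees with T below k} = 2^(m-k)` for `k ≤ m`. -/
theorem card_filter_agree (T : Fin m → Bool) (k : ℕ) (hk : k ≤ m) :
    (Finset.univ.filter fun T' : Fin m → Bool => ∀ i : Fin m, (i : ℕ) < k → T' i = T i).card = 2 ^ (m - k) := by
  classical
  -- the class is the image of `Fin (m-k) → Bool` under «keep T below k, free above»
  let g : (Fin (m - k) → Bool) → (Fin m → Bool) := fun u i =>
    if h : (i : ℕ) < k then T i else u ⟨i - k, by omega⟩
  have hg : Function.Injective g := by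
    intro u v huv
    funext j
    have := congr_fun huv ⟨j + k, by omega⟩
    simp only [g, show ¬ ((j : ℕ) + k < k) by omega, dite_false] at this
    have e : (⟨(j : ℕ) + k - k, by omega⟩ : Fin (m - k)) = j := Fin.ext (by simp)
    rwa [e] at this
  have himg : (Finset.univ.filter fun T' : Fin m → Bool => ∀ i : Fin m, (i : ℕ) < k → T' i = T i)
      = Finset.univ.image g := by
    ext T'
    simp only [Finset.mem_filter, Finset.mem_univ, true_and, Finset.mem_image]
    constructor
    · intro h
      refine ⟨fun j => T' ⟨j + k, by omega⟩, ?_⟩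
      funext i
      by_cases hi : (i : ℕ) < k
      · simp only [g, hi, dite_true]; exact (h i hi).symm
      · simp only [g, hi, dite_false]
        congr 1; exact Fin.ext (by simp only; omega)
    · rintro ⟨u, rfl⟩ i hi
      simp only [g, hi, dite_true]
  rw [himg, Finset.card_image_of_injective _ hg, Finset.card_univ, Fintype.card_fun, Fintype.card_bool,
    Fintype.card_fin]
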